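import Literature.Analysis.FluidPDE.KatoLaiCellRestriction
import Mathlib.Analysis.InnerProductSpace.Calculus
import HarnessLib

/-!
# Kato–Lai in the periodic cylinder: the gradient part of the velocity vanishes

Analysis/FluidPDE support file for the energy-method construction of Euler flows in the
periodic cylinder (`Literature.Analysis.FluidPDE.KatoLai1984_periodicCylinderUniformExistence`;
Kato–Lai 1984, §5, pp. 22–23: "we take the inner product in `H⁰` of (E′) with `Qu(t)` … hence
`‖Qu(t)‖₀ = const = ‖Qφ‖₀ = 0` if `φ ∈ H⁰_σ`. Thus `u = Pu`, and (E′) reduces to (E)").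
For a solution in duality form `u` (`KatoLaiSymForm`) with cell velocity class
`velCell u t = R (i (u t)) ∈ L²(cell)` (`KatoLaiCellRestriction.cellRestrict`):

* `hasDerivWithinAt_velCell` — the strong `L²(cell)` equation `dₜ velCell = −R 𝒜̂ u(t)`;
* `tendsto_cellOf_truncField`, `tendsto_cellOf_klOp_truncField` — the cell classes of the smooth
  truncations `u_N(t)` and of `klOp u_N(t)` converge to `velCell u t` and `R 𝒜̂ u(t)`;
* `inner_helmholtzProj_cellOf_klOp_eq_zero` — for every smooth torus field `U` with cell field
  `u = fromTorus U`, `⟪Q u, 𝒜u⟫_{L²(cell)} = ∫_cell ⟪(Pu·∇_K)(Qu), Qu⟫ = 0` (Kato–Lai (4.10));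
* `inner_helmholtzProj_velCell_cellRestrict_klOpExt_eq_zero` — its limit `⟪Q velCell, R 𝒜̂ u⟫ = 0`;
* `helmholtzProj_velCell_eq_zero` — **`Q u(t) = 0` on `[0, T]`** when `Q u(0) = 0`;
  `helmholtzProj_velCell_zero_of_toSym` — the datum case `u 0 = toSym (torusRep φ)` with `φ`
  divergence free and tangential.

Everything is proved; no named fact and no `sorry` is introduced.

## References

* T. Kato, C. Y. Lai, J. Funct. Anal. 56 (1984) 15–28, §4 (4.10), §5 (pp. 22–23). [KatoLai1984]
-/

noncomputable section

open MeasureTheory Set Function Filter Topology TopologicalSpace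
open scoped NNReal ENNReal InnerProductSpace RealInnerProductSpace ContDiff

namespace Literature.Analysis.FluidPDE

open FunctionSpaces FunctionSpaces.Torus UnitAddTorus

/-- Local notation for physical space `ℝ³ = EuclideanSpace ℝ (Fin 3)`. -/
local notation "ℝ³" => EuclideanSpace ℝ (Fin 3)

/-- Local notation for the closed cylinder `{r ≤ 1}`. -/
local notation "𝕂" => closure (SetLike.coe unitCylinder : Set (EuclideanSpace ℝ (Fin 3)))

namespace PeriodicCylinder

variable {L : ℝ} (hL : 0 < L) (s : ℕ) (ε : ℝ)

/-! ### Coefficient identities -/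

/-- `i (toSym U) = toL2 U`. [folklore] -/
theorem embed_toSym {U : UnitAddTorus (Fin 3) → ℝ³} (hU : IsSmooth U) : embed s ε (toSym s ε hU) = toL2 hU := by
  refine SymL2.ext fun k => ?_
  rw [embed_apply, SymL2.ofSmooth_apply, SymL2.ofSmooth_apply, smul_smul]
  have hw : ((klWeight s ε k : ℝ) : ℂ) ≠ 0 := by exact_mod_cast (klWeight_pos s ε k).ne'
  rw [inv_mul_cancel₀ hw]
  simp

/-- `toL2 (truncField N f) = i (trunc N f)`. [folklore] -/
theorem toL2_truncField (N : ℕ) (f : SymL2 (Fin 3)) : toL2 (isSmooth_truncField s ε N f) = embed s ε (SymL2.trunc N f) := by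
  rw [← embed_toSym s ε (isSmooth_truncField s ε N f), toSym_truncField]

/-- `⟪Q x, Q y⟫ = ⟪Q x, y⟫`: the Helmholtz projection is a self-adjoint idempotent. [folklore] -/
theorem inner_helmholtzProj_helmholtzProj (x y : Lp ℝ³ 2 (cellMeasure L)) :
    ⟪helmholtzProj L x, helmholtzProj L y⟫_ℝ = ⟪helmholtzProj L x, y⟫_ℝ := by
  have hPP : helmholtzProj L (helmholtzProj L x) = helmholtzProj L x := helmholtzProj_eq_self_iff.2 (helmholtzProj_mem x)
  conv_rhs => rw [← hPP]
  simp only [helmholtzProj_apply]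
  exact (Submodule.inner_starProjection_left_eq_right (gradSpace L) _ _).symm

/-! ### The per-field identity `⟪Q u, 𝒜 u⟫ = 0` -/

/-- **Kato–Lai's cancellation for a smooth field**: with `u = fromTorus U`, `w = Pu`, `z = Qu = u − w`,
`⟪Q (cellOf U), cellOf (klOp U)⟫ = ∫_cell ⟪(w·∇_K) z, z⟫ = 0`. [cite: KatoLai1984, §5 (p. 22), §4 (4.10)] -/
theorem inner_helmholtzProj_cellOf_klOp_eq_zero {U : UnitAddTorus (Fin 3) → ℝ³} (hU : IsSmooth U) :
    ⟪helmholtzProj L (cellOf L U), cellOf L (klOp L hL hU)⟫_ℝ = 0 := by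
  have hu := isSmoothPeriodic_fromTorus hL.ne' hU
  set w := lerayPart hL hu with hwdef
  have hw := isSmoothPeriodic_lerayPart hL hu
  have hq := isSmoothPeriodic_lerayPot hL hu
  have hz : IsSmoothPeriodic L (cylGrad (lerayPot hL hu)) := hq.cylGrad
  set z := cylGrad (lerayPot hL hu) with hzdef
  have hb := isSmoothPeriodic_convTerm hL hu
  have hπ := isSmoothPeriodic_pressureGrad hL hu
  have hcell : (cylinderCell L : Set ℝ³) ⊆ 𝕂 := fun x hx => subset_closure (cylinderCell_le_unitCylinder L hx)
  -- `Q (cellOf U) = toCell z`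
  have hQ : helmholtzProj L (cellOf L U) = toCell L z := (lerayPot_spec hL hu).2.1
  -- `cellOf (klOp U) = toCell ((w·∇_K) u − ∇π)`
  have hA : cellOf L (klOp L hL hU) = toCell L (fun x => cylDeriv w (fromTorus L U) x - pressureGrad hL hu x) := by
    refine toCell_congr fun x hx => ?_
    have hxU : x ∈ (unitCylinder : Set ℝ³) := cylinderCell_le_unitCylinder L hx
    rw [fromTorus_klOp_eq hL hU (subset_closure hxU), cylDeriv_eq_fderiv _ _ hxU]
  -- `toCell ∇π = Q (toCell b)`, `b = (w·∇_K) w`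
  have hπQ : toCell L (pressureGrad hL hu) = helmholtzProj L (toCell L (convTerm hL hu)) := ((lerayPot_spec hL hb).2.1).symm
  have hzmem : toCell L z ∈ gradSpace L := gradRange_le_gradSpace (toCell_cylGrad_mem_gradRange hq)
  have hQz : helmholtzProj L (toCell L z) = toCell L z := helmholtzProj_eq_self_iff.2 hzmem
  have hcw : IsSmoothPeriodic L (cylDeriv w (fromTorus L U)) := isSmoothPeriodic_cylDeriv hw hu
  -- `⟪toCell z, Q (toCell b)⟫ = ⟪toCell z, toCell b⟫`
  have hzb : ⟪toCell L z, helmholtzProj L (toCell L (convTerm hL hu))⟫_ℝ = ⟪toCell L z, toCell L (convTerm hL hu)⟫_ℝ := by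
    rw [← hQz, inner_helmholtzProj_helmholtzProj]
  rw [hQ, hA, toCell_sub hcw.memLp hπ.memLp, inner_sub_right, hπQ, hzb, ← inner_sub_right, ← toCell_sub hcw.memLp hb.memLp,
    inner_toCell_toCell hz.memLp (hcw.sub hb).memLp]
  -- pointwise on the cell: `(w·∇)u − (w·∇)w = (w·∇) z`
  have hpt : ∀ x ∈ (cylinderCell L : Set ℝ³), cylDeriv w (fromTorus L U) x - convTerm hL hu x = cylDeriv w z x := by
    intro x hx
    have hxK : x ∈ 𝕂 := hcell hx
    rw [convTerm, ← cylDeriv_sub hu.smooth hw.smooth hxK]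
    congr 1
    funext y
    show fromTorus L U y - (fromTorus L U y - cylGrad (lerayPot hL hu) y) = cylGrad (lerayPot hL hu) y
    abel
  have hcong : ∫ x in (cylinderCell L : Set ℝ³), ⟪z x, cylDeriv w (fromTorus L U) x - convTerm hL hu x⟫_ℝ =
      ∫ x in (cylinderCell L : Set ℝ³), ⟪cylDeriv w z x, z x⟫_ℝ :=
    setIntegral_congr_fun (cylinderCell L).isOpen.measurableSet fun x hx => by rw [hpt x hx, real_inner_comm]
  rw [hcong]
  exact setIntegral_inner_cylDeriv_self_eq_zero hL hw hz (divergence_lerayPart hL hu) (slip_lerayPart hL hu)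

/-! ### Along a solution in duality form -/

section Sol

variable {φ : SymL2 (Fin 3)} {T : ℝ} {u : ℝ → SymL2 (Fin 3)}

/-- **The cell velocity class** `R (i (u t))`. [folklore] -/
def velCell (u : ℝ → SymL2 (Fin 3)) (t : ℝ) : Lp ℝ³ 2 (cellMeasure L) := cellRestrict hL (klVel s ε u t)

/-- **The strong `L²(cell)` equation**: `dₜ velCell u t = −R 𝒜̂ u(t)` within `[0, T]`.
[cite: KatoLai1984, §5 (p. 22)] -/
theorem hasDerivWithinAt_velCell (hu : KatoLai.IsFormSolution (embed s ε) (klForm hL s ε) φ T u) (hT : 0 ≤ T)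
    {t : ℝ} (ht : t ∈ Icc 0 T) :
    HasDerivWithinAt (velCell hL s ε u) (-cellRestrict hL (klOpExt hL s ε (u t))) (Icc 0 T) t := by
  have h := (cellRestrict hL).hasFDerivAt.comp_hasDerivWithinAt t (hasDerivWithinAt_klVel hL s ε hu hT ht)
  rw [map_neg] at h
  exact h

/-- The cell classes of the truncations converge to the velocity class. [folklore] -/
theorem tendsto_cellOf_truncField (f : SymL2 (Fin 3)) :
    Tendsto (fun N => cellOf L (truncField s ε N f)) atTop (𝓝 (cellRestrict hL (embed s ε f))) := by
  have h : ∀ N, cellOf L (truncField s ε N f) = cellRestrict hL (embed s ε (SymL2.trunc N f)) := fun N => by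
    rw [← toL2_truncField, cellRestrict_toL2]
  simp_rw [h]
  exact (((cellRestrict hL).comp (embed s ε)).continuous.tendsto f).comp (SymL2.tendsto_trunc f)

/-- The cell classes of `klOp` of the truncations converge to `R 𝒜̂ f`. [folklore] -/
theorem tendsto_cellOf_klOp_truncField (f : SymL2 (Fin 3)) :
    Tendsto (fun N => cellOf L (klOp L hL (isSmooth_truncField s ε N f))) atTop (𝓝 (cellRestrict hL (klOpExt hL s ε f))) := by
  have h : ∀ N, cellOf L (klOp L hL (isSmooth_truncField s ε N f)) = cellRestrict hL (klOpApprox hL s ε N f) := fun N => by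
    rw [klOpApprox, cellRestrict_toL2]
  simp_rw [h]
  exact ((cellRestrict hL).continuous.tendsto _).comp (tendsto_klOpApprox hL s ε f)

/-- **The cancellation in the limit**: `⟪Q (R (i f)), R (𝒜̂ f)⟫ = 0` for every `f ∈ SymL2`.
[cite: KatoLai1984, §5 (p. 22)] -/
theorem inner_helmholtzProj_cellRestrict_klOpExt_eq_zero (f : SymL2 (Fin 3)) :
    ⟪helmholtzProj L (cellRestrict hL (embed s ε f)), cellRestrict hL (klOpExt hL s ε f)⟫_ℝ = 0 := by
  have h1 := tendsto_cellOf_truncField hL s ε f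
  have h2 := tendsto_cellOf_klOp_truncField hL s ε f
  have h := Filter.Tendsto.inner (𝕜 := ℝ) (((helmholtzProj L).continuous.tendsto _).comp h1) h2
  have h0 : (fun N => ⟪helmholtzProj L (cellOf L (truncField s ε N f)), cellOf L (klOp L hL (isSmooth_truncField s ε N f))⟫_ℝ) =
      fun _ => (0 : ℝ) := funext fun N => inner_helmholtzProj_cellOf_klOp_eq_zero hL (isSmooth_truncField s ε N f)
  rw [show (fun N => ⟪((helmholtzProj L) ∘ fun N => cellOf L (truncField s ε N f)) N, cellOf L (klOp L hL (isSmooth_truncField s ε N f))⟫_ℝ) =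
      fun _ => (0 : ℝ) from h0] at h
  exact tendsto_nhds_unique h tendsto_const_nhds

/-- **The gradient part is constant in time, hence zero**: if `Q (velCell u 0) = 0` then
`Q (velCell u t) = 0` on `[0, T]`. [cite: KatoLai1984, §5 (pp. 22–23)] -/
theorem helmholtzProj_velCell_eq_zero (hu : KatoLai.IsFormSolution (embed s ε) (klForm hL s ε) φ T u) (hT : 0 ≤ T)
    (h0 : helmholtzProj L (velCell hL s ε u 0) = 0) {t : ℝ} (ht : t ∈ Icc 0 T) :
    helmholtzProj L (velCell hL s ε u t) = 0 := by
  -- `E(t) = ‖Q velCell‖²` has zero derivative within `[0, T]`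
  set E : ℝ → ℝ := fun τ => ⟪helmholtzProj L (velCell hL s ε u τ), helmholtzProj L (velCell hL s ε u τ)⟫_ℝ with hE
  have hQd : ∀ τ ∈ Icc 0 T, HasDerivWithinAt (fun σ => helmholtzProj L (velCell hL s ε u σ))
      (helmholtzProj L (-cellRestrict hL (klOpExt hL s ε (u τ)))) (Icc 0 T) τ := fun τ hτ =>
    (helmholtzProj L).hasFDerivAt.comp_hasDerivWithinAt τ (hasDerivWithinAt_velCell hL s ε hu hT hτ)
  have hEd : ∀ τ ∈ Icc 0 T, HasDerivWithinAt E 0 (Icc 0 T) τ := by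
    intro τ hτ
    have h := (hQd τ hτ).inner (𝕜 := ℝ) (hQd τ hτ)
    have hzero : ⟪helmholtzProj L (velCell hL s ε u τ), helmholtzProj L (-cellRestrict hL (klOpExt hL s ε (u τ)))⟫_ℝ = 0 := by
      rw [inner_helmholtzProj_helmholtzProj, inner_neg_right, velCell, klVel, inner_helmholtzProj_cellRestrict_klOpExt_eq_zero, neg_zero]
    have hzero' : ⟪helmholtzProj L (-cellRestrict hL (klOpExt hL s ε (u τ))), helmholtzProj L (velCell hL s ε u τ)⟫_ℝ = 0 := by
      rw [real_inner_comm]; exact hzero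
    rw [hzero, hzero', add_zero] at h
    exact h
  have hEc : ContinuousOn E (Icc 0 T) := fun τ hτ => (hEd τ hτ).continuousWithinAt
  have hEd' : ∀ x ∈ Ico 0 T, HasDerivWithinAt E 0 (Ici x) x := fun x hx =>
    (hEd x ⟨hx.1, hx.2.le⟩).mono_of_mem_nhdsWithin (mem_of_superset (Icc_mem_nhdsGE hx.2) (Icc_subset_Icc hx.1 le_rfl))
  have hconst := constant_of_has_deriv_right_zero hEc hEd' t ht
  have hE0 : E 0 = 0 := by simp [hE, h0]
  rw [hE0] at hconst
  exact inner_self_eq_zero.1 hconst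

/-- **The datum case**: for `u 0 = toSym (torusRep φ)` with `φ` smooth periodic, divergence free
in `{r < 1}` and tangential on `{r = 1}`, `Q (velCell u 0) = 0`. [cite: KatoLai1984, §5 (p. 23)] -/
theorem helmholtzProj_velCell_zero_of_toSym {φc : ℝ³ → ℝ³} (hφ : IsSmoothPeriodic L φc)
    (hdiv : ∀ x ∈ (unitCylinder : Set ℝ³), VectorCalculus.divergence φc x = 0)
    (hslip : ∀ x ∈ frontier (unitCylinder : Set ℝ³), ⟪φc x, eR x⟫_ℝ = 0)
    (h0 : u 0 = toSym s ε (isSmooth_torusRep hφ)) :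
    helmholtzProj L (velCell hL s ε u 0) = 0 := by
  have hcell : (cylinderCell L : Set ℝ³) ⊆ 𝕂 := fun x hx => subset_closure (cylinderCell_le_unitCylinder L hx)
  have h1 : velCell hL s ε u 0 = toCell L φc := by
    rw [velCell, klVel, h0, embed_toSym, cellRestrict_toL2, cellOf]
    exact toCell_congr fun x hx => fromTorus_torusRep_of_mem_K hL hφ.periodic (hcell hx)
  rw [h1]
  exact helmholtzProj_toCell_eq_zero hL hφ hdiv hslip

end Sol

end PeriodicCylinder

end Literature.Analysis.FluidPDE
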